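/- WIDTH seat `ym-line-cbag-p1-w3` (prover-ym-line-cbag-p1-w3-g16-0), LINE 7 `GlueballBandRecursion`, in support of ⟨stmt-QuantumFields-22957⟩
`OneParticleBlochSymbolFamily`: capstone of the Löwdin chain — from w2's projected quasi-band family (`projected_quasiBand_frame`) and an exact
band eigenbasis `e` to the FRAME BLOCK of the registered stub `Band.IsolatedBandFrame` (`ψ` orthonormal, covariant, `𝕋`-invariant span,
`e ∈ span ψ`, `ψ ∈ span e`).  Route-independent; definition-free; a helper. -/
import Summits.QuantumFields.YangMills.Theorems.GlueballBandRecursionQuasiBandIsolationTransfer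
import Summits.QuantumFields.YangMills.Theorems.GlueballBandRecursionCovariantFrame

/-!
# Route `GlueballBandRecursion`, item `OneParticleBlochSymbolFamily` (stmt-QuantumFields-22957): the stub's frame block from a dressed family

`exists_stubFrame_of_dressed_family`: let `e : (ℤ/N)³ × Fin n → L²` be an orthonormal family of eigenvectors of `𝕋 = wilsonTorusTransferMatrix r.ρ β N`
whose span `W` is translation invariant (w2's `exists_isolatedBand_of_quasiBand` delivers this), and let `φ : (ℤ/N)³ × Fin n → L²` be a linearly
independent translation-covariant family inside a subspace `V` SEEN by `W` (`v ∈ V`, `v ⊥ e_k ∀ k ⇒ v = 0`; the dressed one-plaquette excitations).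
Then there is `ψ : (ℤ/N)³ × Fin n → L²` with EXACTLY the frame clauses of `Band.IsolatedBandFrame`: `Orthonormal ℝ ψ`,
`ψ (v + x, j) = koopmanTranslate N v (ψ (x, j))`, `𝕋 (ψ b) ∈ span ψ`, `e_k ∈ span ψ`, `ψ_a ∈ span e` — namely the Löwdin orthonormalisation
(`…CovariantFrame`) of the projected family `P_W φ` (`…QuasiBandIsolationTransfer`).

HONEST FRAMING.  Linear-algebra plumbing; item 22957, LINE 7's rung `ColdDoublingRecursionStrongCoupling` and the Yang–Mills mass gap are NOT
proved or advanced here.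
-/

set_option autoImplicit false

noncomputable section

open scoped InnerProductSpace BigOperators
open MeasureTheory
open Literature.MathematicalPhysics.QuantumFieldTheory

namespace Summit.QuantumFields.YangMills.Theorems.GlueballBandRecursion.Band

variable {G : Type} [Group G] [TopologicalSpace G] [IsTopologicalGroup G] [CompactSpace G]
  [MeasurableSpace G] [BorelSpace G]

/-- **The frame block of `Band.IsolatedBandFrame` from a dressed covariant family.**  See the module docstring. -/
theorem exists_stubFrame_of_dressed_family (r : LatticeRep G) (β : ℝ) (N : ℕ) [NeZero N] {n : ℕ}
    {e : Site 3 N × Fin n → Lp ℝ 2 (Measure.pi fun _ : Edge 3 N => haarProbability G)} (he : Orthonormal ℝ e)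
    {μ : Site 3 N × Fin n → ℝ} (hμ : ∀ k, wilsonTorusTransferMatrix r.ρ β N (e k) = μ k • e k)
    (hinvar : ∀ (v : Site 3 N), ∀ x ∈ Submodule.span ℝ (Set.range e),
      koopmanTranslate N v x ∈ Submodule.span ℝ (Set.range e))
    (V : Submodule ℝ (Lp ℝ 2 (Measure.pi fun _ : Edge 3 N => haarProbability G)))
    (hsee : ∀ v ∈ V, (∀ k, ⟪e k, v⟫_ℝ = 0) → v = 0)
    {φ : Site 3 N × Fin n → Lp ℝ 2 (Measure.pi fun _ : Edge 3 N => haarProbability G)}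
    (hφ : LinearIndependent ℝ φ) (hφV : ∀ a, φ a ∈ V)
    (hcov : ∀ (v x : Site 3 N) (j : Fin n), φ (v + x, j) = koopmanTranslate N v (φ (x, j))) :
    ∃ ψ : Site 3 N × Fin n → Lp ℝ 2 (Measure.pi fun _ : Edge 3 N => haarProbability G),
      Orthonormal ℝ ψ ∧
      (∀ (v x : Site 3 N) (j : Fin n), ψ (v + x, j) = koopmanTranslate N v (ψ (x, j))) ∧
      (∀ b, wilsonTorusTransferMatrix r.ρ β N (ψ b) ∈ Submodule.span ℝ (Set.range ψ)) ∧
      (∀ k, e k ∈ Submodule.span ℝ (Set.range ψ)) ∧ (∀ a, ψ a ∈ Submodule.span ℝ (Set.range e)) := by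
  haveI : FiniteDimensional ℝ (Submodule.span ℝ (Set.range e)) := FiniteDimensional.span_of_finite ℝ (Set.finite_range e)
  -- project the dressed family onto the band `W = span e` (w2): covariant, linearly independent, spanning `W`
  obtain ⟨hli, hcovP, hspan⟩ := projected_quasiBand_frame N he V hsee hinvar hφ hφV hcov rfl
  -- `W` is `𝕋`-invariant (eigenvectors), hence so is the span of the projected family
  have hWT : ∀ x ∈ Submodule.span ℝ (Set.range e), wilsonTorusTransferMatrix r.ρ β N x ∈ Submodule.span ℝ (Set.range e) := by
    intro x hx
    refine Submodule.span_induction (p := fun x _ => wilsonTorusTransferMatrix r.ρ β N x ∈ Submodule.span ℝ (Set.range e))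
      ?_ ?_ ?_ ?_ hx
    · rintro _ ⟨k, rfl⟩
      rw [hμ k]
      exact Submodule.smul_mem _ _ (Submodule.subset_span ⟨k, rfl⟩)
    · rw [map_zero]
      exact Submodule.zero_mem _
    · intro u w _ _ hu hw
      rw [map_add]
      exact Submodule.add_mem _ hu hw
    · intro c u _ hu
      rw [map_smul]
      exact Submodule.smul_mem _ _ hu
  have hinvP : ∀ b, wilsonTorusTransferMatrix r.ρ β N ((Submodule.span ℝ (Set.range e)).starProjection (φ b)) ∈
      Submodule.span ℝ (Set.range fun a => (Submodule.span ℝ (Set.range e)).starProjection (φ a)) := by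
    intro b
    rw [hspan]
    exact hWT _ (Submodule.starProjection_apply_mem _ _)
  -- Löwdin orthonormalisation of the projected family
  obtain ⟨ψ, hψ, hψcov, hψinv, hψspan⟩ := exists_orthonormal_covariant_frame r β N _ hli hcovP hinvP
  refine ⟨ψ, hψ, hψcov, hψinv, fun k => ?_, fun a => ?_⟩
  · rw [hψspan, hspan]
    exact Submodule.subset_span ⟨k, rfl⟩
  · rw [← hspan, ← hψspan]
    exact Submodule.subset_span ⟨a, rfl⟩

end Summit.QuantumFields.YangMills.Theorems.GlueballBandRecursion.Band

end
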